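import Mathlib
import Summits.Ventures.HodgeRepro.Tier4.Common.RowTorus
import Summits.Ventures.HodgeRepro.Tier4.Common.RowWeights
import Summits.Ventures.HodgeRepro.Tier4.Common.LocalUnitary
import Summits.Ventures.HodgeRepro.Tier4.Common.LocalTorusCompact
import Summits.Ventures.HodgeRepro.Tier4.Common.PlaceCommute

/-!
# Tier4/Common/TorusPathAdeles — the norm-one curve `θ ↦ (ξ θ, η θ)` at a real CM place and its adelic lift
(`adOne`, `adZero`): the data of the path `θ ↦ e^{iθ}` in the local torus (the path itself and «`1` is not isolated in
`G(𝔸)`» are the companion `Common/TorusPath.lean`)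

Blind re-derivation cell `pub-hodge-repro`, Tier 4 «prove the step» (README §9–§10), seat t4-typer-2 (gen 4), on
t4-L3-p1 g3's TAKE (S15110) of the offer S15098 (the one input of display (10) `l4_lpInfinite` beyond its own binders:
`lpInfinite_of_nonDiscrete … (hnd : (nhdsWithin (1 : GA W) {1}ᶜ).NeBot)`).  Target tree path
`lean/Summits/Ventures/HodgeRepro/Tier4/Common/TorusPathAdeles.lean` (module 1 of 2; the `400`-line rule splits the module).  Imports: Mathlib + `Common.RowTorus` (`torusUnit`,
`mem_torusT_ofLinesRow_of_blocks`, `blockDiag4R`, `blockOf`), `Common.RowWeights` (`adToC`, `tAt`, `nAt`, `IsCMAt`,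
`wroot_eq`, `weightAt_zero_of_mat`, `weightAt_one`), `Common.LocalUnitary` (`blockOf_one_zero`).

THE CONSTRUCTION.  At a real CM place `w₀` (`t_w² < 4 n_w`), `ω_{w₀} = t_w/2 + i s` with `s = √(4 n_w − t_w²)/2 > 0`, and
the norm-one curve `ξ² + t_w ξ η + n_w η² = 1` is parametrised by `θ ↦ (ξ, η) = (cos θ − (t_w/(2s)) sin θ, sin θ/s)`,
so that `ξ + η ω_{w₀} = cos θ + i sin θ` (`normForm_xi_eta`, `xi_add_eta_mul_wroot`).  Put these real numbers into
`w₀.Completion` (`ringEquivRealOfIsReal`), `1`/`0` at every other place, and build the adeles `xAd θ`, `yAd θ`; the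
norm-one identity holds in `𝔸_k` place by place (`normForm_xAd_yAd`), so RowTorus's `torusUnit (xAd θ) (yAd θ) 1 0` is an
element **`torusPath θ`** of the torus of the row plane (`mem_torusT_ofLinesRow_of_blocks`), supported at `w₀`
(`torusPath_mem_localTorusAt`), continuous in `θ` (`continuous_torusPath`), with `torusPath 0 = 1` and
`weightAt q w₀ 0 (torusPath θ) = cos θ + i sin θ` (`weightAt_torusPath`).  Hence `torusPath θ ≠ 1` for `θ ∈ (0, π)`
(`weightAt_one` and `sin θ > 0`), and `1 ∈ closure {1}ᶜ`: **`nhdsWithin_compl_singleton_neBot_ofLinesRow`**.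

Nothing here says anything about the status of the Hodge conjecture for CM abelian varieties, which is NOT proved
(HC_CM is NOT proved by anyone in this repository).
-/

set_option autoImplicit false

noncomputable section

namespace Summit.Ventures.HodgeRepro.Tier4.Common

open NumberField IsDedekindDomain Matrix Set Topology Filter
open scoped Classical

section RealCurve

variable {k : Type} [Field k] [NumberField k] (q : QuadData k) (w₀ : InfinitePlace k)

/-- `s = √(4 n_w − t_w²) / 2` — the imaginary part of `ω_{w₀}`. -/
def sOf : ℝ := Real.sqrt (4 * (nAt q w₀).re - (tAt q w₀).re ^ 2) / 2

/-- The real part of the curve: `ξ θ = cos θ − (t_w / (2 s)) sin θ`. -/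
def xiR (θ : ℝ) : ℝ := Real.cos θ - ((tAt q w₀).re / (2 * sOf q w₀)) * Real.sin θ

/-- The `ω`-part of the curve: `η θ = sin θ / s`. -/
def etaR (θ : ℝ) : ℝ := Real.sin θ / sOf q w₀

variable {q w₀}

omit [NumberField k] in
/-- `s > 0` at a real CM place. -/
theorem sOf_pos (hcm : IsCMAt q w₀) : 0 < sOf q w₀ := by
  unfold sOf
  have : 0 < 4 * (nAt q w₀).re - (tAt q w₀).re ^ 2 := by unfold IsCMAt at hcm; linarith
  positivity

omit [NumberField k] in
/-- `s² = n_w − t_w² / 4`. -/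
theorem sOf_sq (hcm : IsCMAt q w₀) : sOf q w₀ ^ 2 = (nAt q w₀).re - (tAt q w₀).re ^ 2 / 4 := by
  unfold sOf
  have h : 0 ≤ 4 * (nAt q w₀).re - (tAt q w₀).re ^ 2 := by unfold IsCMAt at hcm; linarith
  rw [div_pow, Real.sq_sqrt h]
  ring

omit [NumberField k] in
/-- **The curve lies on the norm-one conic**: `ξ² + t_w ξ η + n_w η² = 1`. -/
theorem normForm_xi_eta (hcm : IsCMAt q w₀) (θ : ℝ) :
    xiR q w₀ θ ^ 2 + (tAt q w₀).re * xiR q w₀ θ * etaR q w₀ θ + (nAt q w₀).re * etaR q w₀ θ ^ 2 = 1 := by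
  have hs := sOf_pos hcm
  have hsq := sOf_sq hcm
  have hcs := Real.cos_sq_add_sin_sq θ
  unfold xiR etaR
  set s := sOf q w₀ with hsdef
  set τ : ℝ := (tAt q w₀).re / (2 * s) with hτ
  set η : ℝ := Real.sin θ / s with hηdef
  have hT : (tAt q w₀).re = 2 * s * τ := by rw [hτ]; field_simp
  have hτ2 : s ^ 2 * τ ^ 2 = (tAt q w₀).re ^ 2 / 4 := by
    rw [hτ, div_pow, mul_pow]
    field_simp
    ring
  have hN : (nAt q w₀).re = s ^ 2 * (1 + τ ^ 2) := by linear_combination -hsq - hτ2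
  have hη : s * η = Real.sin θ := by rw [hηdef]; field_simp
  rw [hT, hN]
  linear_combination (2 * τ * (Real.cos θ - τ * Real.sin θ) + (1 + τ ^ 2) * (s * η + Real.sin θ)) * hη + hcs

omit [NumberField k] in
/-- `ξ 0 = 1`. -/
theorem xiR_zero : xiR q w₀ 0 = 1 := by simp [xiR]

omit [NumberField k] in
/-- `η 0 = 0`. -/
theorem etaR_zero : etaR q w₀ 0 = 0 := by simp [etaR]

omit [NumberField k] in
/-- `ξ` is continuous. -/
theorem continuous_xiR : Continuous (xiR q w₀) :=
  Real.continuous_cos.sub (continuous_const.mul Real.continuous_sin)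

omit [NumberField k] in
/-- `η` is continuous. -/
theorem continuous_etaR : Continuous (etaR q w₀) := Real.continuous_sin.div_const _

omit [NumberField k] in
/-- **`ξ + η ω_{w₀} = cos θ + i sin θ`** at a real CM place. -/
theorem xi_add_eta_mul_wroot (hw : w₀.IsReal) (hcm : IsCMAt q w₀) (θ : ℝ) :
    (xiR q w₀ θ : ℂ) + (etaR q w₀ θ : ℂ) * wroot q w₀ = (Real.cos θ : ℂ) + (Real.sin θ : ℂ) * Complex.I := by
  have hs := sOf_pos hcm
  have hs' : sOf q w₀ ≠ 0 := hs.ne'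
  have hsqrt : Real.sqrt (4 * (nAt q w₀).re - (tAt q w₀).re ^ 2) = 2 * sOf q w₀ := by
    unfold sOf; ring
  rw [wroot_eq, hsqrt, tAt_eq_re hw]
  apply Complex.ext
  · simp [xiR, etaR, Complex.add_re, Complex.mul_re, Complex.div_re]
    field_simp
    ring
  · simp [xiR, etaR, Complex.add_im, Complex.mul_im, Complex.div_im]
    field_simp

end RealCurve

section Adeles

variable {k : Type} [Field k] [NumberField k] (q : QuadData k) {w₀ : InfinitePlace k} (hw : w₀.IsReal)

/-- A real number as an element of the real completion `w₀.Completion`. -/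
def toW (r : ℝ) : w₀.Completion := (InfinitePlace.Completion.ringEquivRealOfIsReal hw).symm r

omit [NumberField k] in
/-- `toW` inverts the real embedding of the completion. -/
theorem extensionEmbeddingOfIsReal_toW (r : ℝ) :
    InfinitePlace.Completion.extensionEmbeddingOfIsReal hw (toW hw r) = r :=
  (InfinitePlace.Completion.ringEquivRealOfIsReal hw).apply_symm_apply r

omit [NumberField k] in
/-- `toW` is continuous (the inverse of an isometry). -/
theorem continuous_toW : Continuous (toW hw) :=
  (InfinitePlace.Completion.isometryEquivRealOfIsReal hw).symm.continuous

/-- The adele with `w₀`-component `toW r` and component `1` everywhere else. -/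
def adOne (r : ℝ) : Ad k :=
  (Function.update (1 : (w : InfinitePlace k) → w.Completion) w₀ (toW hw r), (1 : FiniteAdeleRing (𝓞 k) k))

/-- The adele with `w₀`-component `toW r` and component `0` everywhere else. -/
def adZero (r : ℝ) : Ad k :=
  (Function.update (0 : (w : InfinitePlace k) → w.Completion) w₀ (toW hw r), (0 : FiniteAdeleRing (𝓞 k) k))

/-- `adOne` is continuous in `r`. -/
theorem continuous_adOne : Continuous (adOne (k := k) hw) :=
  (continuous_const.update w₀ (continuous_toW hw)).prodMk continuous_const

/-- `adZero` is continuous in `r`. -/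
theorem continuous_adZero : Continuous (adZero (k := k) hw) :=
  (continuous_const.update w₀ (continuous_toW hw)).prodMk continuous_const

/-- The `w₀`-component of `adOne r`. -/
theorem adComponentInf_adOne_self (r : ℝ) : adComponentInf k w₀ (adOne hw r) = toW hw r := by
  show Function.update (1 : (w : InfinitePlace k) → w.Completion) w₀ (toW hw r) w₀ = toW hw r
  exact Function.update_self _ _ _

/-- The other infinite components of `adOne r` are `1`. -/
theorem adComponentInf_adOne_of_ne {w : InfinitePlace k} (h : w ≠ w₀) (r : ℝ) :
    adComponentInf k w (adOne hw r) = 1 := by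
  show Function.update (1 : (w : InfinitePlace k) → w.Completion) w₀ (toW hw r) w = 1
  rw [Function.update_of_ne h]
  rfl

/-- The finite components of `adOne r` are `1`. -/
theorem adComponentFin_adOne (v : HeightOneSpectrum (𝓞 k)) (r : ℝ) : adComponentFin k v (adOne hw r) = 1 := by
  show (RestrictedProduct.evalRingHom (fun v : HeightOneSpectrum (𝓞 k) => v.adicCompletion k) v)
    (1 : FiniteAdeleRing (𝓞 k) k) = 1
  exact RingHom.map_one _

/-- The `w₀`-component of `adZero r`. -/
theorem adComponentInf_adZero_self (r : ℝ) : adComponentInf k w₀ (adZero hw r) = toW hw r := by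
  show Function.update (0 : (w : InfinitePlace k) → w.Completion) w₀ (toW hw r) w₀ = toW hw r
  exact Function.update_self _ _ _

/-- The other infinite components of `adZero r` are `0`. -/
theorem adComponentInf_adZero_of_ne {w : InfinitePlace k} (h : w ≠ w₀) (r : ℝ) :
    adComponentInf k w (adZero hw r) = 0 := by
  show Function.update (0 : (w : InfinitePlace k) → w.Completion) w₀ (toW hw r) w = 0
  rw [Function.update_of_ne h]
  rfl

/-- The finite components of `adZero r` are `0`. -/
theorem adComponentFin_adZero (v : HeightOneSpectrum (𝓞 k)) (r : ℝ) : adComponentFin k v (adZero hw r) = 0 := by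
  show (RestrictedProduct.evalRingHom (fun v : HeightOneSpectrum (𝓞 k) => v.adicCompletion k) v)
    (0 : FiniteAdeleRing (𝓞 k) k) = 0
  exact RingHom.map_zero _

/-- The components of a principal adele. -/
theorem adComponentInf_algebraMap' (w : InfinitePlace k) (x : k) :
    adComponentInf k w (algebraMap k (Ad k) x) = algebraMap k w.Completion x := rfl

/-- `adOne 1 = 1`. -/
theorem adOne_one : adOne (k := k) hw 1 = 1 := by
  apply Ad.ext_of_components
  · intro w
    by_cases h : w = w₀
    · subst h
      rw [adComponentInf_adOne_self, map_one]
      unfold toW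
      exact map_one _
    · rw [adComponentInf_adOne_of_ne hw h, map_one]
  · intro v
    rw [adComponentFin_adOne, map_one]

/-- `adZero 0 = 0`. -/
theorem adZero_zero : adZero (k := k) hw 0 = 0 := by
  apply Ad.ext_of_components
  · intro w
    by_cases h : w = w₀
    · subst h
      rw [adComponentInf_adZero_self, map_zero]
      unfold toW
      exact map_zero _
    · rw [adComponentInf_adZero_of_ne hw h, map_zero]
  · intro v
    rw [adComponentFin_adZero, map_zero]

omit [NumberField k] in
/-- The real embedding of `w₀.Completion` on a principal element is the real part of `tAt`/`nAt`-type values. -/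
theorem extensionEmbeddingOfIsReal_algebraMap (x : k) :
    InfinitePlace.Completion.extensionEmbeddingOfIsReal hw (algebraMap k w₀.Completion x) =
      (InfinitePlace.Completion.extensionEmbedding w₀ (algebraMap k w₀.Completion x)).re := by
  rw [← InfinitePlace.Completion.extensionEmbeddingOfIsReal_apply hw, Complex.ofReal_re]

/-- `adToC w₀ (adOne r) = r`. -/
theorem adToC_adOne (r : ℝ) : adToC w₀ (adOne hw r) = (r : ℂ) := by
  rw [show adToC w₀ (adOne hw r) = InfinitePlace.Completion.extensionEmbedding w₀ (adComponentInf k w₀ (adOne hw r))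
    from rfl, adComponentInf_adOne_self, ← InfinitePlace.Completion.extensionEmbeddingOfIsReal_apply hw,
    extensionEmbeddingOfIsReal_toW]

/-- `adToC w₀ (adZero r) = r`. -/
theorem adToC_adZero (r : ℝ) : adToC w₀ (adZero hw r) = (r : ℂ) := by
  rw [show adToC w₀ (adZero hw r) = InfinitePlace.Completion.extensionEmbedding w₀ (adComponentInf k w₀ (adZero hw r))
    from rfl, adComponentInf_adZero_self, ← InfinitePlace.Completion.extensionEmbeddingOfIsReal_apply hw,
    extensionEmbeddingOfIsReal_toW]

/-- **The norm-one identity in `𝔸_k`** for `x := adOne ξ`, `y := adZero η` with `ξ² + t_w ξ η + n_w η² = 1`: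
place by place (`1`/`0` away from `w₀`, the real identity at `w₀`). -/
theorem normForm_adOne_adZero {ξ η : ℝ}
    (h : ξ ^ 2 + (tAt q w₀).re * ξ * η + (nAt q w₀).re * η ^ 2 = 1) :
    adOne hw ξ ^ 2 + algebraMap k (Ad k) q.t * adOne hw ξ * adZero hw η +
      algebraMap k (Ad k) q.n * adZero hw η ^ 2 = 1 := by
  apply Ad.ext_of_components
  · intro w
    simp only [map_add, map_mul, map_pow, map_one, adComponentInf_algebraMap']
    by_cases hww : w = w₀
    · subst hww
      rw [adComponentInf_adOne_self, adComponentInf_adZero_self]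
      apply (InfinitePlace.Completion.bijective_extensionEmbeddingOfIsReal hw).1
      simp only [map_add, map_mul, map_pow, map_one, extensionEmbeddingOfIsReal_toW,
        extensionEmbeddingOfIsReal_algebraMap]
      exact h
    · rw [adComponentInf_adOne_of_ne hw hww, adComponentInf_adZero_of_ne hw hww]
      ring
  · intro v
    simp only [map_add, map_mul, map_pow, map_one, adComponentFin_adOne, adComponentFin_adZero]
    ring

end Adeles

end Summit.Ventures.HodgeRepro.Tier4.Common

end
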